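import Literature.MathematicalPhysics.QuantumFieldTheory.BalabanImbrieJaffe1984to88.BIJ88Eq5128ScalarSector
import Literature.MathematicalPhysics.QuantumFieldTheory.BalabanImbrieJaffe1984to88.BIJ88Eq596FibreIntegral
import Literature.MathematicalPhysics.QuantumFieldTheory.BalabanImbrieJaffe1984to88.BIJ88Measure5127

/-!
# `BalabanImbrieJaffe1984to88.BIJ88Eq5128ScalarFunction` — T. Bałaban, J. Imbrie, A. Jaffe, *Effective action and cluster properties of the abelian
Higgs model*, Commun. Math. Phys. **114** (1988) 257–315 [BalabanImbrieJaffe1988], p. 300 [PDF 44] (*"a Gaussian integral in φ^{(k)}, and we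
wish to apply the formula for conditioning"*), (5.12.1)–(5.12.2) p. 301, (5.12.7) p. 302, (5.12.8) p. 303 [PDF 45–47]: **(5.12.8) AS A FUNCTION OF
`(v, ψ)` WITH THE SCALAR GAUSSIAN CONDITIONING BY NAME.**  Joins this seat's two gen-11 files: `BIJ88Eq5128ScalarSector` (p317381: the scalar
sector of the conditioning on the torus carriers — p10's weight `wIn·cpl`, `𝒩 = calN = Z_{Λ₁₀}·e^{thirdForm}`, the p. 302 Gaussian reading — in gen 10's
TESTED frame, under the locality hypothesis `hv` of the block field) and `BIJ88Eq596FibreIntegral` (p318611: (5.12.8) as a FUNCTION identity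
`isDT_ae_eq_cond`, no locality hypothesis).  At a FIXED block field `v` the scalar-sector lemmas are read with the constant block map `u ↦ v`, for which
their locality hypothesis holds trivially (`vCut_const_freeze`) and the precision is `M_t(v)` (`Mq_const`); the fibre factorization `hfac` of the
function-level frame is then DISCHARGED for brackets `X₀·exp(−½⟨φ^{(k)}, M_t(v)φ^{(k)}⟩)·B₀` (`hfac_scalar_fibre`).

statement-level skeleton of published theorems with citation tags; proofs where landed; nothing here is a claim about the Yang–Mills mass gap

PDF held: `paper:balaban1988-cmp114-bij-abelian-higgs-effective-action` (journal page = PDF page + 256); pp. 300–303 [PDF 44–47] re-read this session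
(renders `HOME/lit-balaban-p02/pages/original-p044-x2.png`, `-p045-x2.png`).
CITATION HEADER (lean-in-tree rule).  Part of the lit-balaban TYPED SKELETON (HOME `run/shared/lean/pub/lit-balaban/`), PHASE-2 proof seat p34 gen 11
(unit `lit-balaban-p34-g11`; own lineage).  Rows served (owner r16, ROWS-C2-part2): **C2.Eq5.12.8** (function form, scalar sector by name:
`ae_eq_cond_scalar`, `_axial`), support **C2.Eq5.12.1-5.12.7** ((5.12.1) third form + `Z_{Λ₁₀}`; (5.12.7) scalar law p. 302: `interior_scalar_obs`, v1.1 `map_xOf_condW_eq_muφ`; (5.12.6) v1.1 `interior_scalar_obs_locTransl`).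

THE READING (carriers of record; nothing re-declared).  As in the two companion files; `M_t(v)` = the real symmetric matrix of the `φ^{(k)}`-Gaussian of
term `t` at the block field `v` (print: `Δ_{k,loc}(u_{k+1}) + aL^{−2}P(u_{k+1})`, `u_{k+1} = u_{k+1}(v)`), positive definite `Λ₁₀`-block, measurable in `v`;
`X₀_t` (interior-independent) and `B₀_t` the remaining factors of the fibre bracket.

WHAT IS PROVED (kernel-checked; theorems only — no `def`, no `Prop`-valued fact; standard axioms; imports the two companion files and, from v1.1, p02's `BIJ88Measure5127`).
* §1 `vCut_const`, `vCut_const_freeze`, `Mq_const`, **`hfac_scalar_fibre`** (the fibre factorization for the scalar sector).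
* §2 **`ae_eq_cond_scalar`**: `IsDT (Π_b m_b) terms Λ Q J ρ̃` (+ substitution invariance, integrability) and the scalar structure of the fibre bracket ⟹
  `ρ̃(v, ψ) =ᵐ Σ_t ∫_{ext_t} X₀_t · e^{−½⟨Λ₁₀ᶜφ, M_t(v)Λ₁₀ᶜφ⟩} · [Z_{Λ₁₀}(M_t(v))·e^{thirdForm(M_t(v); φ|_{Λ₁₀ᶜ})}] · (∫B₀_t dμ^{(k)}_{Λ₁₀,t}) d(ext_t)` with
  `dμ^{(k)}_{Λ₁₀,t} = condW` of the scalar weight `sW` at `v` (weight data `measurable_sW`/`sW_pos`/`integrable_sW_fibre`, `normW_sW`,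
  `calN_eq_Zscalar_mul_exp_thirdForm` of the companion, by name); **`ae_eq_cond_scalar_axial`** (`𝒟u δ_{Ax}`).
* §3 **`interior_scalar_obs`**: under that interior law the interior real coordinates are p10's `gaussProb(M_t(v)_Λ)` translated by `−M_Λ⁻¹J(y)` (p. 302
  *"uncentered, normalized Gaussian measure … covariances C^{(k)}_{Λ₁₀}(u_{k+1}), and nonzero means"*).
* §4 (v1.1, same seat/gen; adds the import of p02's `BIJ88Measure5127`): **`map_xOf_condW_eq_muφ`** — the law of the interior coordinates under
  `dμ^{(k)}_{Λ₁₀,t}` IS p02's `BIJ88Measure5127.muφ (M_t(v)_Λ) (J(y))` as a MEASURE ((5.12.7), scalar factor, by name); **`interior_scalar_obs_locTransl`** —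
  (5.12.6)–(5.12.7) for the scalar sector with ANY localized covariance `C`: *"the same translation in both numerator and denominator … Terms quadratic
  … cancel"*, the residual linear form `(I − M_ΛC)J` of (5.12.7) in the exponent (p10's `integral_tilt`; the algebra of p02's
  `BIJ88LocTransl5126.approxSquare`).
NOT DONE HERE (honest scope).  The gauge sector of (5.12.7) by name (HOME/GAPS.md G-C2-23); the identification of `M_t(v)` with the printed operator
`Δ_k(u_{k+1}) + aL^{−2}P(u_{k+1})` and of `C` with the random-walk localization `C^{(k)}_{Λ_{10},loc}` (row C2.Eq5.12.1-5.12.7's carriers, p02); bounds.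
-/

namespace Literature.MathematicalPhysics.QuantumFieldTheory.BalabanImbrieJaffe1984to88.BIJ88Eq5128ScalarFunction

open Literature.MathematicalPhysics.QuantumFieldTheory.Balaban1983to89
open BIJ88Sect3Statements (U1)
open BIJ85Sect1Model (HiggsField)
open BIJ88RenormTransf311 (axialMeasure)
open BIJ88InductiveForm41 (Prev prevMeasure)
open BIJ85BlockAveragesTorus (qU surfMul uPrime)
open BIJ88Eq536Linearization (cutoff)
open BIJ88Eq531TranslLaw (axialMeasure_map_surfMul)
open BIJ88RT52Restrictions (Fields fieldsMeasure)
open BIJ88Eq596Display (uCut vCut vCut_apply IsDT)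
open BIJ88Eq5128CondExpect (condNorm condMeasure)
open BIJ88Eq5128Split (Cfg Interior)
open BIJ88Eq5128Display (axialLaw axialMeasure_eq_pi_axialLaw)
open BIJ88Eq5128Display.Weight (normW condW)
open BIJ88Eq5128Frame (isDT_axial_iff)
open B2Eq228Conditioning (In Out blkIn blkOut)
open BIJ88Conditioning512 (wIn cpl calN srcJ)
open B13GaugeDevices (gaussWeight gaussInt gaussNorm gaussInt_one_eq_gaussNorm)
open B2Eq228Conditioning (gaussProb)
open BIJ88ExteriorForms5121 (Zscalar thirdForm)
open BIJ88Eq5128ScalarSector (RIdx realCoords inIx xOf yOf Mq sW sX exp_quadForm_glue sX_freeze realCoords_eq_glue measurable_sW sW_pos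
  integrable_sW_fibre normW_sW calN_eq_Zscalar_mul_exp_thirdForm integral_condW_sW_scalar_obs)
open BIJ88Eq596FibreIntegral (isDT_ae_eq_cond pi_axialLaw_map_surfMul)
open scoped BigOperators ENNReal Matrix
open _root_.MeasureTheory _root_.MeasureTheory.Measure Function Set

noncomputable section

variable {P : Params} {k : ℕ}

section Scalar

variable {ι : Type*} {terms : Finset ι} {Λ : ι → Finset (PBond P (k+1))} {D : ι → Interior P k}
variable {M : ι → GaugeField P (k+1) U1 → Matrix (RIdx P k) (RIdx P k) ℝ}
variable {m : PBond P k → Measure U1} [∀ b, IsProbabilityMeasure (m b)]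
variable {J : ι → Prev P k → GaugeField P k U1 → GaugeField P (k+1) U1 → HiggsField P k → HiggsField P (k+1) → ℂ}
variable {ρL : GaugeField P (k+1) U1 → HiggsField P (k+1) → ℂ}

/-! ## §1 At a FIXED block field `v` the scalar weight of `BIJ88Eq5128ScalarSector` is read with the constant block map -/

/-- kernel: with the block field a PARAMETER `v` (the function-level displays of `BIJ88Eq596FibreIntegral`) the block field of the display read through a
constant block map is `v`. [cite: BalabanImbrieJaffe1988, (5.12.8) p.303] -/
theorem vCut_const (Λ₀ : Finset (PBond P (k+1))) (U : GaugeField P k U1) (v : GaugeField P (k+1) U1) :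
    vCut (fun _ : GaugeField P k U1 => v) Λ₀ U v = v := by
  funext c
  rw [vCut_apply]
  split_ifs <;> rfl

/-- kernel: hence the locality hypothesis `hvq` of the scalar-sector lemmas holds trivially at a fixed block field. [cite: BalabanImbrieJaffe1988, (5.12.8) p.303] -/
theorem vCut_const_freeze (t : ι) (v : GaugeField P (k+1) U1) (q : Cfg P k) :
    vCut (fun _ : GaugeField P k U1 => v) (Λ t) ((D t).freeze q).1 v = vCut (fun _ : GaugeField P k U1 => v) (Λ t) q.1 v := by
  rw [vCut_const, vCut_const]

/-- kernel: the precision read on a configuration at a fixed block field is `M_t(v)`. [cite: BalabanImbrieJaffe1988, (5.12.2) p.301] -/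
theorem Mq_const (t : ι) (q : Cfg P k) (v : GaugeField P (k+1) U1) : Mq Λ (fun _ : GaugeField P k U1 => v) M t q v = M t v := by
  show M t (vCut (fun _ : GaugeField P k U1 => v) (Λ t) q.1 v) = M t v
  rw [vCut_const]

/-- **THE FIBRE FACTORIZATION OF THE SCALAR SECTOR** (the hypothesis `hfac` of `BIJ88Eq596FibreIntegral.isDT_ae_eq_cond`, DISCHARGED): if the fibre
bracket at the block field `v` is `X₀ · exp(−½⟨φ^{(k)}, M_t(v)φ^{(k)}⟩) · B₀` with `X₀` not depending on the interior variables and `M_t(v)` symmetric, it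
factors as (exterior factor ∘ freeze) × (p10's `wIn · cpl`, the scalar weight `sW` read with the constant block map) × `B₀`
(`BIJ88Eq5128ScalarSector.exp_quadForm_glue`). [cite: BalabanImbrieJaffe1988, (5.12.2) p.301] -/
theorem hfac_scalar_fibre (hMs : ∀ t v, (M t v).IsSymm) {X₀ B₀ : ι → Cfg P k → GaugeField P (k+1) U1 → HiggsField P (k+1) → ℂ}
    (hX₀ : ∀ t ∈ terms, ∀ q v ψ, X₀ t ((D t).freeze q) v ψ = X₀ t q v ψ)
    (hJ : ∀ t ∈ terms, ∀ (q : Cfg P k) (v : GaugeField P (k+1) U1) (ψ : HiggsField P (k+1)),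
      J t q.2.1 (surfMul (uPrime q.1) (cutoff (Λ t)ᶜ v)) v q.2.2 ψ =
        X₀ t q v ψ * (Real.exp (-(1 / 2 : ℝ) * (realCoords q.2.2 ⬝ᵥ (M t v *ᵥ realCoords q.2.2))) : ℂ) * B₀ t q v ψ) :
    ∀ t ∈ terms, ∀ (q : Cfg P k) (v : GaugeField P (k+1) U1) (ψ : HiggsField P (k+1)),
      J t q.2.1 (surfMul (uPrime q.1) (cutoff (Λ t)ᶜ v)) v q.2.2 ψ =
        (X₀ t ((D t).freeze q) v ψ * (sX Λ (fun _ : GaugeField P k U1 => v) D M t ((D t).freeze q) v : ℂ)) *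
          (sW Λ (fun _ : GaugeField P k U1 => v) D M t q v : ℂ) * B₀ t q v ψ := by
  intro t ht q v ψ
  rw [hJ t ht q v ψ, hX₀ t ht, sX_freeze (vCut_const_freeze t v q), realCoords_eq_glue (D t) q, exp_quadForm_glue _ _ (hMs t _)]
  simp only [sW, sX, Mq_const]
  push_cast
  ring

/-! ## §2 (5.12.8) as a FUNCTION of `(v, ψ)` with the scalar Gaussian conditioning by name -/

/-- **(5.12.8) AS A FUNCTION OF `(v, ψ)`, SCALAR SECTOR BY NAME (PROVED).**  From line 1 of (5.9.6) over `u ~ Π_b m_b` (substitution-invariant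
one-bond laws of mass one; brackets integrable in the untranslated variable; `ρ̃` integrable) whose fibre bracket at the block field `v` is
`X₀_t · exp(−½⟨φ^{(k)}, M_t(v)φ^{(k)}⟩) · B₀_t` (`M_t(v)` symmetric, positive definite `Λ₁₀`-block, measurable in `v`; `X₀_t` interior-independent): for
`dv dψ`-a.e. `(v, ψ)`,
`ρ̃(v, ψ) = Σ_t ∫_{ext_t} X₀_t · e^{−½⟨Λ₁₀ᶜφ, M_t(v)Λ₁₀ᶜφ⟩} · [Z_{Λ₁₀}(M_t(v)) e^{thirdForm}] · (∫ B₀_t dμ^{(k)}_{Λ₁₀,t}) d(ext_t)` — the exterior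
`φ`-Gaussian replaced by the third form of (5.12.1) times `Z_{Λ₁₀}(u_{k+1})` (p02's `Zscalar`/`thirdForm`, p10's `calN`), the interior law `dμ^{(k)}_{Λ₁₀}` =
`𝒩⁻¹·(wIn·cpl)·(interior law)` (gen 10's `condW` of the scalar weight `sW`).  NO locality hypothesis (the block field is the parameter `v`): the weight is
read with the constant block map. [cite: BalabanImbrieJaffe1988, (5.12.8) p.303] -/
theorem ae_eq_cond_scalar (hk : k + 1 ≤ P.m + P.K) (hν : ∀ w, (Measure.pi m).map (fun U => surfMul U w) = Measure.pi m)
    (h : IsDT (Measure.pi m) terms Λ qU J ρL)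
    (hJi : ∀ t ∈ terms, Integrable (fun q : Fields P k => J t q.2.1 (uCut qU (Λ t) q.1) (qU q.1) q.2.2.1 q.2.2.2) (fieldsMeasure (Measure.pi m)))
    (hi : Integrable (uncurry ρL) ((fieldMeasure P (k+1) U1).prod volume))
    (hMs : ∀ t v, (M t v).IsSymm) (hMpd : ∀ t v, (blkIn (inIx (D t)) (M t v)).PosDef) (hMm : ∀ t i j, Measurable fun v => M t v i j)
    (X₀ B₀ : ι → Cfg P k → GaugeField P (k+1) U1 → HiggsField P (k+1) → ℂ)
    (hX₀ : ∀ t ∈ terms, ∀ q v ψ, X₀ t ((D t).freeze q) v ψ = X₀ t q v ψ)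
    (hJ : ∀ t ∈ terms, ∀ (q : Cfg P k) (v : GaugeField P (k+1) U1) (ψ : HiggsField P (k+1)),
      J t q.2.1 (surfMul (uPrime q.1) (cutoff (Λ t)ᶜ v)) v q.2.2 ψ =
        X₀ t q v ψ * (Real.exp (-(1 / 2 : ℝ) * (realCoords q.2.2 ⬝ᵥ (M t v *ᵥ realCoords q.2.2))) : ℂ) * B₀ t q v ψ) :
    uncurry ρL =ᵐ[(fieldMeasure P (k+1) U1).prod volume]
      uncurry (fun v ψ => ∑ t ∈ terms, ∫ q, X₀ t q v ψ * (sX Λ (fun _ : GaugeField P k U1 => v) D M t q v : ℂ) *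
        ((Zscalar (inIx (D t)) (M t v) * Real.exp (thirdForm (inIx (D t)) (M t v) (M t v) (yOf (D t) q)) : ℝ) : ℂ) *
        ∫ q', B₀ t q' v ψ ∂condW (D t) m (fun q' => sW Λ (fun _ : GaugeField P k U1 => v) D M t q' v) q ∂(D t).extMeasure m) := by
  have key := isDT_ae_eq_cond hk hν h hJi hi D
    (fun t q v ψ => X₀ t q v ψ * (sX Λ (fun _ : GaugeField P k U1 => v) D M t q v : ℂ)) B₀
    (fun t q v _ => sW Λ (fun _ : GaugeField P k U1 => v) D M t q v) (hfac_scalar_fibre hMs hX₀ hJ)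
    (fun t _ v _ => measurable_sW (Qu := fun _ : GaugeField P k U1 => v) measurable_const hMm t measurable_id measurable_const)
    (fun t _ q v _ => sW_pos t q v)
    (fun t _ e v _ => integrable_sW_fibre (m := m) hMs hMpd t v (fun q => vCut_const_freeze t v q) e)
  filter_upwards [key] with z hz
  rw [hz]
  simp only [uncurry]
  refine Finset.sum_congr rfl fun t _ => integral_congr_ae (Filter.Eventually.of_forall fun q => ?_)
  show X₀ t q z.1 z.2 * (sX Λ (fun _ : GaugeField P k U1 => z.1) D M t q z.1 : ℂ) *
      (normW (D t) m (fun q' => sW Λ (fun _ : GaugeField P k U1 => z.1) D M t q' z.1) q : ℂ) *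
        ∫ q', B₀ t q' z.1 z.2 ∂condW (D t) m (fun q' => sW Λ (fun _ : GaugeField P k U1 => z.1) D M t q' z.1) q = _
  rw [normW_sW (m := m) t z.1 (fun q' => vCut_const_freeze t z.1 q') q, Mq_const,
    calN_eq_Zscalar_mul_exp_thirdForm _ _ (hMs t _) (hMpd t _)]

/-- **Instance `ν = ∫𝒟u δ_{Ax}(u)(·)`** (the measure of (5.9.6); exterior measures over the one-bond laws `axialLaw`). [cite: BalabanImbrieJaffe1988, (5.12.8) p.303] -/
theorem ae_eq_cond_scalar_axial (hk : k + 1 ≤ P.m + P.K) (h : IsDT (axialMeasure P k U1) terms Λ qU J ρL)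
    (hJi : ∀ t ∈ terms, Integrable (fun q : Fields P k => J t q.2.1 (uCut qU (Λ t) q.1) (qU q.1) q.2.2.1 q.2.2.2) (fieldsMeasure (axialMeasure P k U1)))
    (hi : Integrable (uncurry ρL) ((fieldMeasure P (k+1) U1).prod volume))
    (hMs : ∀ t v, (M t v).IsSymm) (hMpd : ∀ t v, (blkIn (inIx (D t)) (M t v)).PosDef) (hMm : ∀ t i j, Measurable fun v => M t v i j)
    (X₀ B₀ : ι → Cfg P k → GaugeField P (k+1) U1 → HiggsField P (k+1) → ℂ)
    (hX₀ : ∀ t ∈ terms, ∀ q v ψ, X₀ t ((D t).freeze q) v ψ = X₀ t q v ψ)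
    (hJ : ∀ t ∈ terms, ∀ (q : Cfg P k) (v : GaugeField P (k+1) U1) (ψ : HiggsField P (k+1)),
      J t q.2.1 (surfMul (uPrime q.1) (cutoff (Λ t)ᶜ v)) v q.2.2 ψ =
        X₀ t q v ψ * (Real.exp (-(1 / 2 : ℝ) * (realCoords q.2.2 ⬝ᵥ (M t v *ᵥ realCoords q.2.2))) : ℂ) * B₀ t q v ψ) :
    uncurry ρL =ᵐ[(fieldMeasure P (k+1) U1).prod volume]
      uncurry (fun v ψ => ∑ t ∈ terms, ∫ q, X₀ t q v ψ * (sX Λ (fun _ : GaugeField P k U1 => v) D M t q v : ℂ) *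
        ((Zscalar (inIx (D t)) (M t v) * Real.exp (thirdForm (inIx (D t)) (M t v) (M t v) (yOf (D t) q)) : ℝ) : ℂ) *
        ∫ q', B₀ t q' v ψ ∂condW (D t) (axialLaw P k) (fun q' => sW Λ (fun _ : GaugeField P k U1 => v) D M t q' v) q
        ∂(D t).extMeasure (axialLaw P k)) := by
  have h' : IsDT (Measure.pi (axialLaw P k)) terms Λ qU J ρL := isDT_axial_iff.mp h
  have hJi' : ∀ t ∈ terms, Integrable (fun q : Fields P k => J t q.2.1 (uCut qU (Λ t) q.1) (qU q.1) q.2.2.1 q.2.2.2)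
      (fieldsMeasure (Measure.pi (axialLaw P k))) := by
    rw [← axialMeasure_eq_pi_axialLaw]; exact hJi
  exact ae_eq_cond_scalar hk pi_axialLaw_map_surfMul h' hJi' hi hMs hMpd hMm X₀ B₀ hX₀ hJ

/-! ## §3 The interior scalar law of the function-level display, by name (p. 302) -/

/-- **p. 302 for the function-level display**: under the interior law `dμ^{(k)}_{Λ₁₀,t}` at the block field `v`, the interior real coordinates
`x = φ^{(k)″}|_{Λ₁₀}` of `q′` are distributed by p10's Gaussian probability measure of covariance `C_{Λ₁₀} = M_t(v)_Λ⁻¹` translated by the mean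
`−M_t(v)_Λ⁻¹ J(y)`, `J(y) = Λ₁₀M_t(v)Λ₁₀ᶜφ` (*"an uncentered, normalized Gaussian measure … covariances C^{(k)}_{Λ₁₀}(u_{k+1}), and nonzero means"*;
`BIJ88Eq5128ScalarSector.integral_condW_sW_scalar_obs` read with the constant block map). [cite: BalabanImbrieJaffe1988, (5.12.7) p.302] -/
theorem interior_scalar_obs (hMs : ∀ t v, (M t v).IsSymm) (hMpd : ∀ t v, (blkIn (inIx (D t)) (M t v)).PosDef)
    (hMm : ∀ t i j, Measurable fun v => M t v i j) (t : ι) (v : GaugeField P (k+1) U1) (e : (D t).Ext) (i : (D t).Int)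
    (G : (In (inIx (D t)) → ℝ) → ℝ) :
    ∫ q', G (xOf (D t) q') ∂condW (D t) m (fun q' => sW Λ (fun _ : GaugeField P k U1 => v) D M t q' v) ((D t).glue e i) =
      ∫ z, G (z - (blkIn (inIx (D t)) (M t v))⁻¹ *ᵥ srcJ (inIx (D t)) (M t v) (yOf (D t) ((D t).glue e i)))
        ∂B2Eq228Conditioning.gaussProb (blkIn (inIx (D t)) (M t v)) := by
  rw [integral_condW_sW_scalar_obs (m := m) (Qu := fun _ : GaugeField P k U1 => v) measurable_const hMm hMs hMpd t v
    (fun q => vCut_const_freeze t v q) e i G, Mq_const]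


/-! ## §4 (v1.1) The interior scalar law BY NAME: p02's `muφ`; (5.12.6)–(5.12.7) with a localized covariance -/

/-- **THE INTERIOR SCALAR LAW IS p02's `muφ` (row C2.Eq5.12.1-5.12.7, member (5.12.7), scalar factor — as MEASURES).**  Under the interior law
`dμ^{(k)}_{Λ₁₀,t}` of the function-level display at the block field `v`, the law of the interior real coordinates `x = φ^{(k)″}|_{Λ₁₀}` IS
`BIJ88Measure5127.muφ (M_t(v)_Λ) (J(y))` — the normalized centred Gaussian of covariance `M_Λ⁻¹` translated by `−M_Λ⁻¹J(y)` (*"This measure has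
covariances … C^{(k)}_{Λ₁₀}(u_{k+1}), and nonzero means"*, p. 302). [cite: BalabanImbrieJaffe1988, (5.12.7) p.302] -/
theorem map_xOf_condW_eq_muφ (hMs : ∀ t v, (M t v).IsSymm) (hMpd : ∀ t v, (blkIn (inIx (D t)) (M t v)).PosDef)
    (hMm : ∀ t i j, Measurable fun v => M t v i j) (t : ι) (v : GaugeField P (k+1) U1) (e : (D t).Ext) (i : (D t).Int) :
    (condW (D t) m (fun q' => sW Λ (fun _ : GaugeField P k U1 => v) D M t q' v) ((D t).glue e i)).map (xOf (D t)) =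
      BIJ88Measure5127.muφ (blkIn (inIx (D t)) (M t v)) (srcJ (inIx (D t)) (M t v) (yOf (D t) ((D t).glue e i))) := by
  haveI : IsProbabilityMeasure (condW (D t) m (fun q' => sW Λ (fun _ : GaugeField P k U1 => v) D M t q' v) ((D t).glue e i)) :=
    BIJ88Eq5128Display.Weight.isProbabilityMeasure_condW (fun q => sW_pos t q v)
      (fun e' => integrable_sW_fibre (m := m) hMs hMpd t v (fun q => vCut_const_freeze t v q) e') _
  haveI : IsProbabilityMeasure (BIJ88Measure5127.muφ (blkIn (inIx (D t)) (M t v)) (srcJ (inIx (D t)) (M t v) (yOf (D t) ((D t).glue e i)))) :=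
    BIJ88Measure5127.isProbabilityMeasure_muφ _ _ (hMpd t v)
  refine Measure.ext fun s hs => ?_
  have hind : Measurable (s.indicator (1 : (In (inIx (D t)) → ℝ) → ℝ)) := measurable_const.indicator hs
  have h1 : ((condW (D t) m (fun q' => sW Λ (fun _ : GaugeField P k U1 => v) D M t q' v) ((D t).glue e i)).map (xOf (D t))).real s =
      (BIJ88Measure5127.muφ (blkIn (inIx (D t)) (M t v)) (srcJ (inIx (D t)) (M t v) (yOf (D t) ((D t).glue e i)))).real s := by
    rw [← integral_indicator_one hs, ← integral_indicator_one hs,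
      integral_map (BIJ88Eq5128ScalarSector.measurable_xOf (D t)).aemeasurable hind.aestronglyMeasurable,
      interior_scalar_obs (m := m) hMs hMpd hMm t v e i (s.indicator 1), BIJ88Measure5127.muφ,
      integral_map (measurable_sub_const _).aemeasurable hind.aestronglyMeasurable]
  rw [← ofReal_measureReal, h1, ofReal_measureReal]

/-- **(5.12.6)–(5.12.7) FOR THE SCALAR SECTOR, WITH ANY LOCALIZED COVARIANCE `C`** (p. 302: *"We make the same translation in both numerator and
denominator of the normalized integral in Λ^{(k)}_{10} … We remove most of these forms with localized translations φ^{(k)} = φ^{(k)″} −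
C^{(k)}_{Λ^{(k)}_{10},loc}(u_{k+1})Δ_{k,loc}(u_{k+1})Λ^{(k)c}_{10}φ^{(k)}. (5.12.6) Terms quadratic in Λ^{(k)c}_{10}φ^{(k)} cancel as before, leaving the
following integral"*): for EVERY matrix `C` on the interior coordinates, the interior expectation of an observable `G(x)` is the ratio of the
translated integrals with the residual linear form `(I − M_ΛC)J` of (5.12.7) in the exponent —
`∫G dμ^{(k)}_{Λ₁₀} = ∫dx″ e^{−⟨(I−M_ΛC)J, x″⟩ − ½⟨x″, M_Λx″⟩} G(x″ − CJ) / ∫dx″ e^{−⟨(I−M_ΛC)J, x″⟩ − ½⟨x″, M_Λx″⟩}` (the algebra is p02's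
`BIJ88LocTransl5126.approxSquare`; here through p10's linear shift `integral_tilt`: with `C = M_Λ⁻¹` the linear form vanishes, `approxSquare_exact`).
[cite: BalabanImbrieJaffe1988, (5.12.6) p.302] -/
theorem interior_scalar_obs_locTransl (hMs : ∀ t v, (M t v).IsSymm) (hMpd : ∀ t v, (blkIn (inIx (D t)) (M t v)).PosDef)
    (hMm : ∀ t i j, Measurable fun v => M t v i j) (t : ι) (v : GaugeField P (k+1) U1) (e : (D t).Ext) (i : (D t).Int)
    (G : (In (inIx (D t)) → ℝ) → ℝ) (C : Matrix (In (inIx (D t))) (In (inIx (D t))) ℝ) :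
    ∫ q', G (xOf (D t) q') ∂condW (D t) m (fun q' => sW Λ (fun _ : GaugeField P k U1 => v) D M t q' v) ((D t).glue e i) =
      (∫ x, Real.exp (-((srcJ (inIx (D t)) (M t v) (yOf (D t) ((D t).glue e i)) -
            blkIn (inIx (D t)) (M t v) *ᵥ (C *ᵥ srcJ (inIx (D t)) (M t v) (yOf (D t) ((D t).glue e i)))) ⬝ᵥ x) -
          1 / 2 * (x ⬝ᵥ (blkIn (inIx (D t)) (M t v) *ᵥ x))) *
        G (x - C *ᵥ srcJ (inIx (D t)) (M t v) (yOf (D t) ((D t).glue e i)))) /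
      (∫ x, Real.exp (-((srcJ (inIx (D t)) (M t v) (yOf (D t) ((D t).glue e i)) -
            blkIn (inIx (D t)) (M t v) *ᵥ (C *ᵥ srcJ (inIx (D t)) (M t v) (yOf (D t) ((D t).glue e i)))) ⬝ᵥ x) -
          1 / 2 * (x ⬝ᵥ (blkIn (inIx (D t)) (M t v) *ᵥ x)))) := by
  set A := blkIn (inIx (D t)) (M t v) with hA
  set J := srcJ (inIx (D t)) (M t v) (yOf (D t) ((D t).glue e i)) with hJ
  have hAs : A.IsSymm := BIJ88Conditioning512.blkIn_isSymm (inIx (D t)) (M t v) (hMs t v)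
  have hdet : IsUnit A.det := isUnit_iff_ne_zero.2 (hMpd t v).det_pos.ne'
  -- the translated numerator and denominator through the linear shift (`integral_tilt`)
  have hshift : ∀ z : In (inIx (D t)) → ℝ, z - A⁻¹ *ᵥ (J - A *ᵥ (C *ᵥ J)) - C *ᵥ J = z - A⁻¹ *ᵥ J := by
    intro z
    rw [Matrix.mulVec_sub, Matrix.mulVec_mulVec, Matrix.nonsing_inv_mul A hdet, Matrix.one_mulVec]
    abel
  have hnum : ∫ x, Real.exp (-((J - A *ᵥ (C *ᵥ J)) ⬝ᵥ x) - 1 / 2 * (x ⬝ᵥ (A *ᵥ x))) * G (x - C *ᵥ J) =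
      Real.exp (1 / 2 * ((J - A *ᵥ (C *ᵥ J)) ⬝ᵥ (A⁻¹ *ᵥ (J - A *ᵥ (C *ᵥ J))))) * gaussInt A (fun z => G (z - A⁻¹ *ᵥ J)) := by
    rw [B2Eq228Conditioning.integral_tilt A hAs hdet (J - A *ᵥ (C *ᵥ J)) (fun x => G (x - C *ᵥ J))]
    simp only [hshift]
  have hden : ∫ x, Real.exp (-((J - A *ᵥ (C *ᵥ J)) ⬝ᵥ x) - 1 / 2 * (x ⬝ᵥ (A *ᵥ x))) =
      Real.exp (1 / 2 * ((J - A *ᵥ (C *ᵥ J)) ⬝ᵥ (A⁻¹ *ᵥ (J - A *ᵥ (C *ᵥ J))))) * gaussNorm A := by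
    have h1 := B2Eq228Conditioning.integral_tilt A hAs hdet (J - A *ᵥ (C *ᵥ J)) (fun _ => (1 : ℝ))
    simp only [mul_one] at h1
    rw [h1, gaussInt_one_eq_gaussNorm]
  rw [interior_scalar_obs (m := m) hMs hMpd hMm t v e i G, hnum, hden,
    mul_div_mul_left _ _ (Real.exp_pos _).ne', B2Eq228Conditioning.integral_gaussProb_eq, div_eq_inv_mul]
  simp only [gaussInt, smul_eq_mul, hA, hJ]

end Scalar

end

end Literature.MathematicalPhysics.QuantumFieldTheory.BalabanImbrieJaffe1984to88.BIJ88Eq5128ScalarFunction
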